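import Summits.AtomisticToContinuum.HydrodynamicLimit.Theorems.InformationPercolationEngineChaosClosesEulerPressureValueH
import HarnessLib

/-!
# Collisional pressure value in band (crux `ChaosClosesEuler`, stmt-AtomisticToContinuum-15141, line `Sketch`,
# stub `stub_pressureValueOfEnskog`) — helper I: the Enskog side along a good orbit (integrands and their bounds)

WHAT. The space–time integrands of the Enskog side of the value identification, read along ONE good orbit
`s ↦ Φₛz` at fixed `r, L`, with the in-band cutoff `gc` (continuous, `|gc · Y| ≤ C_gY` on `[0, ∞)`, `gc = 0` on
`[η₀, ∞)`):

* `F₁ = gc(σ³ρ_r) Y(σ³ρ_r) B_r(𝒯[L,k,l])` — the integrand of the windowed Enskog rate of the truncated stress mark: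
  jointly measurable, bounded, and with SPACE INTEGRAL `≤ C_gY (8π/5)(η₀/σ³) ke` at every instant (the a-priori bound
  `|B_r(𝒯)| ≤ (12π/5)ρ_r²θ_r` of helper B, one factor `σ³ρ_r < η₀` in band, `ρ_rθ_r ≤ ⅔e_r`, `∫e_r = ke`);
* the quadratic speed-tail field `MpsiC (sqTail L)`, the value integrand `X = Σ a_kl W′ (B_r(𝒯) − (4π/3)ρ²θδ)`
  (`W′ = σ³ gc Y`), the stress-isotropy integrand `g̃(σ³ρ_r) Σ ã_kl P_kl` and the pressure integrand
  `2 g p_ex tr a`: jointly measurable and bounded (so that the Fubini toolkit of helper E applies).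

References: elementary; S. Chapman, T. G. Cowling (1970) §16.4.
-/

noncomputable section

namespace Summit.AtomisticToContinuum.HydrodynamicLimit.Theorems.ChaosClosesEulerPressureValue

open scoped BigOperators Topology Classical MeasureTheory ENNReal InnerProductSpace
open Filter Set MeasureTheory
open Literature.MathematicalPhysics.KineticTheory
open Literature.Analysis.FluidPDE
open Summit.AtomisticToContinuum.HydrodynamicLimit.Theorems.LocalSecondLawNegative
open Summit.AtomisticToContinuum.HydrodynamicLimit.Theorems.LocalSecondLawLedger
open Summit.AtomisticToContinuum.HydrodynamicLimit.Theorems.LocalSecondLawLedger.L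
  (Mmom rhoC_eq_sum momC_apply_eq_sum momC_eq_sum kinC_eq_trace norm_sq_eq_sum)

/-- The truncated stress mark `𝒯[L,k,l]` (local notation for an explicit lambda). -/
local notation3 "𝒯[" L ", " k ", " l "]" => fun q : V3 × V3 × V3 =>
  min |⟪q.2.1 - q.2.2, q.1⟫_ℝ| (4 * L) * (speedCutoff L ‖q.2.1‖ * speedCutoff L ‖q.2.2‖) * (clip1 (q.1 k) * clip1 (q.1 l))

/-- The dominating mark `ℬ[L]` (local notation for an explicit lambda). -/
local notation3 "ℬ[" L "]" => fun q : V3 × V3 × V3 => 4 * L * (speedCutoff L ‖q.2.1‖ * speedCutoff L ‖q.2.2‖)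

section WeightedSplit

open Summit.AtomisticToContinuum.HydrodynamicLimit.Theorems.ChaosClosesEulerStressIsotropy

variable {N : ℕ}

/-- **The weighted contraction, pointwise**: for `|a_kl| ≤ A` and a scalar weight `W`,
`|Σ_kl a_kl W (B_r(𝒯[L,k,l]) − (4π/3)ρ²θδ_kl) − (8π/15)(Wρ_r) Σ_kl ã_kl P_kl| ≤ 120π A |W| ρ_r M(sqTail L)`
(`0 < r`, `0 < L`). [folklore] -/
theorem abs_weighted_sum_sub_le {L r : ℝ} (hL : 0 < L) (hr : 0 < r) (w : Phase N) (x : T3) (a : Fin 3 → Fin 3 → ℝ)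
    {A : ℝ} (hA : ∀ k l, |a k l| ≤ A) (W : ℝ) :
    |(∑ k : Fin 3, ∑ l : Fin 3, a k l * (W * (pairFunctional r 𝒯[L, k, l] w x -
        4 * Real.pi / 3 * (rhoC r w x ^ 2 * thetaC r w x) * (if k = l then 1 else 0)))) -
      8 * Real.pi / 15 * (W * rhoC r w x) * ∑ k : Fin 3, ∑ l : Fin 3,
        (a k l - (∑ j : Fin 3, a j j) / 3 * (if k = l then 1 else 0)) *
          (MpsiC r w x (fun v => v k * v l) - momC r w x k * momC r w x l / rhoC r w x)| ≤
      120 * Real.pi * A * |W| * (rhoC r w x * MpsiC r w x (sqTail L)) := by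
  have hA0 : 0 ≤ A := (abs_nonneg _).trans (hA 0 0)
  set D : Fin 3 → Fin 3 → ℝ := fun m n =>
    (MpsiC r w x (fun v => speedCutoff L ‖v‖) * MpsiC r w x (fun v => v m * v n * speedCutoff L ‖v‖) -
      MpsiC r w x (fun v => v m * speedCutoff L ‖v‖) * MpsiC r w x (fun v => v n * speedCutoff L ‖v‖)) -
      (rhoC r w x * Mmom r w x m n - momC r w x m * momC r w x n) with hD
  have hDb : ∀ m n, |D m n| ≤ 10 * (rhoC r w x * MpsiC r w x (sqTail L)) := fun m n => abs_Q_sub_le hL hr w x m n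
  set T := rhoC r w x * MpsiC r w x (sqTail L) with hT
  have hT0 : 0 ≤ T := (abs_nonneg _).trans (hDb 0 0) |> fun h => by linarith
  -- rewrite every `B − (4π/3)ρ²θδ` through the split
  have hsplit : ∀ k l, pairFunctional r 𝒯[L, k, l] w x -
      4 * Real.pi / 3 * (rhoC r w x ^ 2 * thetaC r w x) * (if k = l then 1 else 0) =
      4 * Real.pi / 15 * ((if k = l then 1 else 0) * ∑ m : Fin 3, D m m + 2 * D k l) +
        8 * Real.pi / 15 * (rhoC r w x * devC r w x k l) := fun k l => pairFunctional_markT_sub_eq hL hr w x k l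
  simp_rw [hsplit]
  have hlin : ∑ k : Fin 3, ∑ l : Fin 3, a k l * (W * (4 * Real.pi / 15 * ((if k = l then 1 else 0) * ∑ m : Fin 3, D m m +
      2 * D k l) + 8 * Real.pi / 15 * (rhoC r w x * devC r w x k l))) =
      4 * Real.pi / 15 * W * ∑ k : Fin 3, ∑ l : Fin 3, a k l * ((if k = l then 1 else 0) * ∑ m : Fin 3, D m m + 2 * D k l) +
        8 * Real.pi / 15 * W * ∑ k : Fin 3, ∑ l : Fin 3, a k l * (rhoC r w x * devC r w x k l) := by
    simp only [Finset.mul_sum, ← Finset.sum_add_distrib]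
    exact Finset.sum_congr rfl fun k _ => Finset.sum_congr rfl fun l _ => by ring
  rw [hlin, sum_mul_rhoC_mul_devC_eq hr w x a]
  have hcancel : 4 * Real.pi / 15 * W * ∑ k : Fin 3, ∑ l : Fin 3, a k l * ((if k = l then 1 else 0) * ∑ m : Fin 3, D m m +
      2 * D k l) + 8 * Real.pi / 15 * W * (rhoC r w x * ∑ k : Fin 3, ∑ l : Fin 3,
        (a k l - (∑ j : Fin 3, a j j) / 3 * (if k = l then 1 else 0)) *
          (MpsiC r w x (fun v => v k * v l) - momC r w x k * momC r w x l / rhoC r w x)) -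
      8 * Real.pi / 15 * (W * rhoC r w x) * ∑ k : Fin 3, ∑ l : Fin 3,
        (a k l - (∑ j : Fin 3, a j j) / 3 * (if k = l then 1 else 0)) *
          (MpsiC r w x (fun v => v k * v l) - momC r w x k * momC r w x l / rhoC r w x) =
      4 * Real.pi / 15 * W * ∑ k : Fin 3, ∑ l : Fin 3, a k l * ((if k = l then 1 else 0) * ∑ m : Fin 3, D m m +
        2 * D k l) := by ring
  rw [hcancel, abs_mul, abs_mul, abs_of_nonneg (by positivity : (0 : ℝ) ≤ 4 * Real.pi / 15)]
  -- the contraction is at most `5 A Σ_mn |D_mn| ≤ 450 A T`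
  have hsumD : ∑ m : Fin 3, ∑ n : Fin 3, |D m n| ≤ 9 * (10 * T) :=
    calc ∑ m : Fin 3, ∑ n : Fin 3, |D m n| ≤ ∑ _m : Fin 3, ∑ _n : Fin 3, 10 * T :=
          Finset.sum_le_sum fun m _ => Finset.sum_le_sum fun n _ => hDb m n
      _ = 9 * (10 * T) := by simp only [Finset.sum_const, Finset.card_univ, Fintype.card_fin, nsmul_eq_mul]; ring
  have htrD : |∑ m : Fin 3, D m m| ≤ 3 * (10 * T) :=
    calc |∑ m : Fin 3, D m m| ≤ ∑ m : Fin 3, |D m m| := Finset.abs_sum_le_sum_abs _ _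
      _ ≤ ∑ _m : Fin 3, 10 * T := Finset.sum_le_sum fun m _ => hDb m m
      _ = 3 * (10 * T) := by simp only [Finset.sum_const, Finset.card_univ, Fintype.card_fin, nsmul_eq_mul]; ring
  have hterm : ∀ k l, |a k l * ((if k = l then 1 else 0) * ∑ m : Fin 3, D m m + 2 * D k l)| ≤
      A * (3 * (10 * T)) + 2 * A * |D k l| := by
    intro k l
    rw [abs_mul]
    have h1 : |(if k = l then (1 : ℝ) else 0) * ∑ m : Fin 3, D m m + 2 * D k l| ≤ 3 * (10 * T) + 2 * |D k l| := by
      refine (abs_add_le _ _).trans ?_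
      rw [abs_mul (2 : ℝ), abs_two]
      have : |(if k = l then (1 : ℝ) else 0) * ∑ m : Fin 3, D m m| ≤ 3 * (10 * T) := by
        split_ifs
        · rw [one_mul]; exact htrD
        · rw [zero_mul, abs_zero]; positivity
      linarith
    calc |a k l| * |(if k = l then (1 : ℝ) else 0) * ∑ m : Fin 3, D m m + 2 * D k l| ≤ A * (3 * (10 * T) + 2 * |D k l|) :=
          mul_le_mul (hA k l) h1 (abs_nonneg _) hA0
      _ = A * (3 * (10 * T)) + 2 * A * |D k l| := by ring
  have hcontr : |∑ k : Fin 3, ∑ l : Fin 3, a k l * ((if k = l then 1 else 0) * ∑ m : Fin 3, D m m + 2 * D k l)| ≤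
      450 * A * T := by
    calc _ ≤ ∑ k : Fin 3, ∑ l : Fin 3, |a k l * ((if k = l then 1 else 0) * ∑ m : Fin 3, D m m + 2 * D k l)| :=
          (Finset.abs_sum_le_sum_abs _ _).trans (Finset.sum_le_sum fun k _ => Finset.abs_sum_le_sum_abs _ _)
      _ ≤ ∑ k : Fin 3, ∑ l : Fin 3, (A * (3 * (10 * T)) + 2 * A * |D k l|) :=
          Finset.sum_le_sum fun k _ => Finset.sum_le_sum fun l _ => hterm k l
      _ = 9 * (A * (3 * (10 * T))) + 2 * A * ∑ k : Fin 3, ∑ l : Fin 3, |D k l| := by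
          simp only [Finset.sum_add_distrib, Finset.sum_const, Finset.card_univ, Fintype.card_fin, nsmul_eq_mul,
            ← Finset.mul_sum]
          push_cast; ring
      _ ≤ 9 * (A * (3 * (10 * T))) + 2 * A * (9 * (10 * T)) := by nlinarith [hsumD, hA0]
      _ = 450 * A * T := by ring
  calc 4 * Real.pi / 15 * |W| * |∑ k : Fin 3, ∑ l : Fin 3, a k l * ((if k = l then 1 else 0) * ∑ m : Fin 3, D m m +
        2 * D k l)| ≤ 4 * Real.pi / 15 * |W| * (450 * A * T) := by gcongr
    _ = 120 * Real.pi * A * |W| * T := by ring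

end WeightedSplit

section EnskogSide

open Function
open Summit.AtomisticToContinuum.HydrodynamicLimit.Theorems.ChaosClosesEulerStressIsotropy

variable {σ : ℝ} {N : ℕ} (Φ : HardSphereFlow (Torus.geometry (Fin 3)) (hsDiameter σ N) (N + 1)) {z : Phase N}

/-! ## §1 Finite sums under the iterated integral -/

/-- Finite sums of bounded jointly measurable fields come out of the iterated integral. [folklore] -/
theorem setIntegral_integral_finsetSum {ι : Type*} (S : Finset ι) {F : ι → ℝ → T3 → ℝ}
    (hF : ∀ i ∈ S, Measurable (uncurry (F i))) {C : ι → ℝ} (hFb : ∀ i ∈ S, ∀ s x, |F i s x| ≤ C i) (lo up : ℝ) :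
    ∫ s in Icc lo up, ∫ x, ∑ i ∈ S, F i s x = ∑ i ∈ S, ∫ s in Icc lo up, ∫ x, F i s x := by
  have h1 : ∀ s, ∫ x, ∑ i ∈ S, F i s x = ∑ i ∈ S, ∫ x, F i s x := fun s =>
    integral_finsetSum _ fun i hS => integrable_slice (hF i hS) (hFb i hS) s
  simp_rw [h1]
  exact integral_finsetSum _ fun i hS => integrableOn_integral_slice (hF i hS) (hFb i hS) lo up

/-! ## §2 The Enskog integrand `F₁ = gc(σ³ρ) Y(σ³ρ) B_r(𝒯)` -/

/-- `F₁` is jointly measurable along a good orbit. [folklore] -/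
theorem measurable_F1 (hz : z ∈ Φ.good) {gc : ℝ → ℝ} (hgc : Continuous gc) (r L : ℝ) (k l : Fin 3) :
    Measurable (uncurry fun (s : ℝ) (x : T3) => gc (σ ^ 3 * rhoC r (Φ.flow s z) x) *
      contactValue (σ ^ 3 * rhoC r (Φ.flow s z) x) * pairFunctional r 𝒯[L, k, l] (Φ.flow s z) x) := by
  have hγ := measurable_flow_of_mem_good Φ hz
  have hρ : Measurable fun p : ℝ × T3 => σ ^ 3 * rhoC r (Φ.flow p.1 z) p.2 :=
    measurable_const.mul (ChaosClosesEulerReduction.measurable_rhoC_orbit hγ r)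
  exact ((hgc.measurable.comp hρ).mul (EvenStressEnskog.measurable_contactValue.comp hρ)).mul
    (measurable_pairFunctional_orbit Φ hz (continuous_sphereMark_markT L k l) r)

/-- `|F₁| ≤ C_gY (3/(πr³))² (32π/5) L²` (`σ ≥ 0`, `0 < r`, `0 < L`). [folklore] -/
theorem abs_F1_le (hσ : 0 ≤ σ) {r L : ℝ} (hr : 0 < r) (hL : 0 < L) {gc : ℝ → ℝ} {CgY : ℝ}
    (hgY : ∀ b, 0 ≤ b → |gc b * contactValue b| ≤ CgY) (k l : Fin 3) (s : ℝ) (x : T3) :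
    |gc (σ ^ 3 * rhoC r (Φ.flow s z) x) * contactValue (σ ^ 3 * rhoC r (Φ.flow s z) x) *
        pairFunctional r 𝒯[L, k, l] (Φ.flow s z) x| ≤ CgY * ((3 / (Real.pi * r ^ 3)) ^ 2 * (32 * Real.pi / 5 * L ^ 2)) := by
  have hb : 0 ≤ σ ^ 3 * rhoC r (Φ.flow s z) x := mul_nonneg (pow_nonneg hσ 3) (rhoC_nonneg hr _ _)
  rw [abs_mul]
  exact mul_le_mul (hgY _ hb) (abs_pairFunctional_markT_le_const hL hr _ x k l) (abs_nonneg _)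
    ((abs_nonneg _).trans (hgY _ hb))

/-- **Pointwise energy domination of `F₁` in band**: `|F₁| ≤ C_gY (12π/5)(η₀/σ³)(⅔) e_r` when `gc` vanishes on
`[η₀, ∞)` (`0 < σ`). [folklore] -/
theorem abs_F1_le_kinC (hσ : 0 < σ) {r L : ℝ} (hr : 0 < r) (hL : 0 < L) {gc : ℝ → ℝ} {CgY η₀ : ℝ} (hη₀ : 0 ≤ η₀)
    (hgY : ∀ b, 0 ≤ b → |gc b * contactValue b| ≤ CgY) (hg0 : ∀ b, η₀ ≤ b → gc b = 0) (k l : Fin 3) (s : ℝ) (x : T3) :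
    |gc (σ ^ 3 * rhoC r (Φ.flow s z) x) * contactValue (σ ^ 3 * rhoC r (Φ.flow s z) x) *
        pairFunctional r 𝒯[L, k, l] (Φ.flow s z) x| ≤
      CgY * (12 * Real.pi / 5) * (η₀ / σ ^ 3) * (2 / 3 * kinC r (Φ.flow s z) x) := by
  set w := Φ.flow s z with hw
  have hσ3 : 0 < σ ^ 3 := pow_pos hσ 3
  have hρ0 := rhoC_nonneg hr w x
  have hb : 0 ≤ σ ^ 3 * rhoC r w x := mul_nonneg hσ3.le hρ0
  have hCgY : 0 ≤ CgY := (abs_nonneg _).trans (hgY _ hb)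
  have hρθ0 := psvK_rhoC_mul_thetaC_nonneg hr w x
  have hρθ := psvK_rhoC_mul_thetaC_le hr w x
  by_cases hband : η₀ ≤ σ ^ 3 * rhoC r w x
  · rw [hg0 _ hband, zero_mul, zero_mul, abs_zero]
    have : 0 ≤ η₀ / σ ^ 3 := div_nonneg hη₀ hσ3.le
    have hk := kinC_nonneg hr w x
    positivity
  · push Not at hband
    have hρle : rhoC r w x ≤ η₀ / σ ^ 3 := by
      rw [le_div_iff₀ hσ3, mul_comm]; exact hband.le
    rw [abs_mul]
    calc |gc (σ ^ 3 * rhoC r w x) * contactValue (σ ^ 3 * rhoC r w x)| * |pairFunctional r 𝒯[L, k, l] w x|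
        ≤ CgY * (12 * Real.pi / 5 * (rhoC r w x ^ 2 * thetaC r w x)) :=
          mul_le_mul (hgY _ hb) (abs_pairFunctional_markT_le hL hr w x k l) (abs_nonneg _) hCgY
      _ = CgY * (12 * Real.pi / 5) * (rhoC r w x * (rhoC r w x * thetaC r w x)) := by ring
      _ ≤ CgY * (12 * Real.pi / 5) * (η₀ / σ ^ 3 * (2 / 3 * kinC r w x)) := by
          refine mul_le_mul_of_nonneg_left (mul_le_mul hρle hρθ hρθ0 ((hρ0).trans hρle)) (by positivity)
      _ = _ := by ring

/-- **The space integral of `|F₁|` at every instant of a good orbit is `≤ C_gY (8π/5)(η₀/σ³) ke(z)`**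
(`0 < σ`, `0 < r < 1/2`). [folklore] -/
theorem integral_abs_F1_le (hz : z ∈ Φ.good) (hσ : 0 < σ) {r L : ℝ} (hr : 0 < r) (hr2 : r < 1 / 2) (hL : 0 < L)
    {gc : ℝ → ℝ} (hgc : Continuous gc) {CgY η₀ : ℝ} (hη₀ : 0 ≤ η₀) (hgY : ∀ b, 0 ≤ b → |gc b * contactValue b| ≤ CgY)
    (hg0 : ∀ b, η₀ ≤ b → gc b = 0) (k l : Fin 3) (s : ℝ) :
    ∫ x, |gc (σ ^ 3 * rhoC r (Φ.flow s z) x) * contactValue (σ ^ 3 * rhoC r (Φ.flow s z) x) *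
        pairFunctional r 𝒯[L, k, l] (Φ.flow s z) x| ≤ CgY * (8 * Real.pi / 5) * (η₀ / σ ^ 3) * ke z := by
  have hm := measurable_F1 Φ hz hgc r L k l (σ := σ)
  have hI : Integrable (fun x => |gc (σ ^ 3 * rhoC r (Φ.flow s z) x) * contactValue (σ ^ 3 * rhoC r (Φ.flow s z) x) *
      pairFunctional r 𝒯[L, k, l] (Φ.flow s z) x|) volume :=
    (integrable_slice hm (abs_F1_le Φ hσ.le hr hL hgY k l) s).abs
  have hIk : Integrable (fun x => CgY * (12 * Real.pi / 5) * (η₀ / σ ^ 3) * (2 / 3 * kinC r (Φ.flow s z) x)) volume :=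
    ((integrable_of_continuous_T3 (continuous_kinC r _)).const_mul _).const_mul _
  calc _ ≤ ∫ x, CgY * (12 * Real.pi / 5) * (η₀ / σ ^ 3) * (2 / 3 * kinC r (Φ.flow s z) x) :=
        integral_mono hI hIk fun x => abs_F1_le_kinC Φ hσ hr hL hη₀ hgY hg0 k l s x
    _ = CgY * (12 * Real.pi / 5) * (η₀ / σ ^ 3) * (2 / 3 * ∫ x, kinC r (Φ.flow s z) x) := by
        rw [integral_const_mul, integral_const_mul]
    _ = CgY * (8 * Real.pi / 5) * (η₀ / σ ^ 3) * ke z := by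
        rw [integral_kinC_eq_ke hr hr2, ke_flow_eq Φ hz s]; ring

/-! ## §3 The quadratic speed-tail field -/

/-- The tail field `MpsiC (sqTail L)` along a good orbit is jointly measurable and lies in `[0, 2 (3/(πr³)) ke(z)]`.
[folklore] -/
theorem tailField_measurable_mem (hz : z ∈ Φ.good) {r : ℝ} (hr : 0 < r) (L : ℝ) :
    Measurable (uncurry fun (s : ℝ) (x : T3) => MpsiC r (Φ.flow s z) x (sqTail L)) ∧
      ∀ s x, 0 ≤ MpsiC r (Φ.flow s z) x (sqTail L) ∧
        MpsiC r (Φ.flow s z) x (sqTail L) ≤ 2 * (3 / (Real.pi * r ^ 3) * ke z) :=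
  ⟨measurable_MpsiC_orbit (measurable_flow_of_mem_good Φ hz) r (measurable_sqTail L),
    fun s x => ⟨MpsiC_sqTail_nonneg hr _ x L,
      (MpsiC_sqTail_le_two_kinC hr _ x L).trans (by linarith [kinC_flow_le Φ hz hr s x])⟩⟩

/-- `∫ₓ MpsiC (sqTail L) = (N+1)⁻¹ Σᵢ sqTail L vᵢ` (unit cone mass). [folklore] -/
theorem integral_tailField (w : Phase N) {r : ℝ} (hr : 0 < r) (hr2 : r < 1 / 2) (L : ℝ) :
    ∫ x, MpsiC r w x (sqTail L) = ((N + 1 : ℕ) : ℝ)⁻¹ * ∑ i, sqTail L (w i).2 := integral_MpsiC hr hr2 w _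

/-! ## §4 The central second moments and the state fields -/

/-- The central second moment `P_kl = MpsiC(v_kv_l) − mₖmₗ/ρ_r` along a good orbit is jointly measurable and bounded
by `(10/3)(3/(πr³)) ke(z)`. [folklore] -/
theorem Pfield_measurable_le (hz : z ∈ Φ.good) {r : ℝ} (hr : 0 < r) (k l : Fin 3) :
    Measurable (uncurry fun (s : ℝ) (x : T3) => MpsiC r (Φ.flow s z) x (fun v => v k * v l) -
      momC r (Φ.flow s z) x k * momC r (Φ.flow s z) x l / rhoC r (Φ.flow s z) x) ∧
      ∀ s x, |MpsiC r (Φ.flow s z) x (fun v => v k * v l) -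
        momC r (Φ.flow s z) x k * momC r (Φ.flow s z) x l / rhoC r (Φ.flow s z) x| ≤
          10 / 3 * (3 / (Real.pi * r ^ 3) * ke z) := by
  have hγ := measurable_flow_of_mem_good Φ hz
  have hψ : Measurable fun v : V3 => v k * v l :=
    ((EuclideanSpace.proj k : V3 →L[ℝ] ℝ).continuous.mul (EuclideanSpace.proj l : V3 →L[ℝ] ℝ).continuous).measurable
  refine ⟨(measurable_MpsiC_orbit hγ r hψ).sub
    (((ChaosClosesEulerReduction.measurable_momC_apply_orbit hγ r k).mul
      (ChaosClosesEulerReduction.measurable_momC_apply_orbit hγ r l)).div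
      (ChaosClosesEulerReduction.measurable_rhoC_orbit hγ r)), fun s x => ?_⟩
  rw [← Mmom_eq_MpsiC]
  exact (ChaosClosesEulerReduction.abs_Pm_le_kinC hr _ x k l).trans
    (mul_le_mul_of_nonneg_left (kinC_flow_le Φ hz hr s x) (by norm_num))

/-- `ρ_r²θ_r` along a good orbit: jointly measurable, in `[0, (3/(πr³))² (2/3) ke(z)]`. [folklore] -/
theorem rhoSqTheta_measurable_mem (hz : z ∈ Φ.good) {r : ℝ} (hr : 0 < r) :
    Measurable (uncurry fun (s : ℝ) (x : T3) => rhoC r (Φ.flow s z) x ^ 2 * thetaC r (Φ.flow s z) x) ∧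
      ∀ s x, 0 ≤ rhoC r (Φ.flow s z) x ^ 2 * thetaC r (Φ.flow s z) x ∧
        rhoC r (Φ.flow s z) x ^ 2 * thetaC r (Φ.flow s z) x ≤ 3 / (Real.pi * r ^ 3) * (2 / 3 * (3 / (Real.pi * r ^ 3) * ke z)) := by
  have hγ := measurable_flow_of_mem_good Φ hz
  refine ⟨((ChaosClosesEulerReduction.measurable_rhoC_orbit hγ r).pow_const 2).mul
    (ChaosClosesEulerReduction.measurable_thetaC_orbit hγ r), fun s x => ?_⟩
  have h := rhoC_sq_mul_thetaC_mem hr (Φ.flow s z) x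
  refine ⟨h.1, h.2.trans ?_⟩
  exact mul_le_mul_of_nonneg_left (mul_le_mul_of_nonneg_left (kinC_flow_le Φ hz hr s x) (by norm_num)) (by positivity)

end EnskogSide

/-! ## Registered sub-goal -/

/-- **Registered sub-goal `stub_pressureValueI` (helper I of `stub_pressureValueOfEnskog`): the space integral of
the cone quadratic-tail moment is the mean quadratic tail.** [folklore] -/
theorem stub_pressureValueI : ∀ {N : ℕ} (w : Phase N) {r : ℝ}, 0 < r → r < 1 / 2 → ∀ (L : ℝ), ∫ x, ChaosClosesEulerStressIsotropy.MpsiC r w x (ChaosClosesEulerStressIsotropy.sqTail L) = ((N + 1 : ℕ) : ℝ)⁻¹ * ∑ i, ChaosClosesEulerStressIsotropy.sqTail L (w i).2 :=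
  fun w _ hr hr2 L => integral_tailField w hr hr2 L

end Summit.AtomisticToContinuum.HydrodynamicLimit.Theorems.ChaosClosesEulerPressureValue

end
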